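import Literature.NumberTheory.Sieve.BombieriFriedlanderIwaniecCaseA
import Literature.NumberTheory.Sieve.BombieriFriedlanderIwaniecCaseB
import Literature.NumberTheory.Sieve.BombieriFriedlanderIwaniecInteriorTools
import Literature.NumberTheory.Sieve.BombieriFriedlanderIwaniecCombinatorics
import HarnessLib

/-!
# Bombieri–Friedlander–Iwaniec 1986, §17: the interior box-tuples

Topic `Literature/NumberTheory/Sieve`, companion to `…CaseA`, `…CaseB`, `…InteriorTools` and
`…Combinatorics` (the partial-sum dichotomy `exists_subsum_mem_Icc_or`).  Everything here is PROVED
(from the named facts of BFI 1986 — Theorems 0 (b), 1, 2, 5*, Lemma 3 — and Shiu's theorem,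
Siegel–Walfisz for `μ`, the fundamental lemma).  This is the combinatorial heart of the proof of
Theorem 10 (§17, p. 249): an interior tuple of boxes of a sieved Heath-Brown piece is grouped into a
bilinear form `α ⋆ β` according to the exponents of its boxes and fed to the matching mean-value
theorem.

* `Literature.NumberTheory.Sieve.BFI.genuine_pieces_bound` — for a family of nonzero pieces in boxes
  `(P_i, (1+Δ)P_i]`, `P_i ≥ 1`, with `X' = ∏ P_i ∈ [x, 2^{15} x]`: the dichotomy on the exponents
  `e_i = log P_i / log X'` (`a = 3/14 − ε/2 + ε/200`, `b = 2a`) and the dispatch to `sparse_bound`,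
  `caseA1_bound`, `caseA2_bound` (with (A₂) from `siegelWalfiszHyp_prod_pieces`), `caseB1_bound`,
  `caseB2_bound`;
* `Literature.NumberTheory.Sieve.BFI.interior_tuple_bound` — for an interior tuple `κ` of a
  Heath-Brown piece: the factors whose box lies below `1` are Dirichlet units and are discarded, the
  others form such a family; conclusion
  `|∑_{d ≤ x^{4/7−ε}, (d,a)=1} λ(d) · sievedDisc (PMain κ) d a z x| ≤ C x (log x)^{−A₅}` (`z = exp(√log x)`).

## References

* E. Bombieri, J. B. Friedlander, H. Iwaniec, *Primes in arithmetic progressions to large moduli*,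
  Acta Math. 156 (1986), 203–251, §15 pp. 244–246, §17 p. 249. [BombieriFriedlanderIwaniecActa1986]
-/

open Finset Real
open scoped ArithmeticFunction.sigma ArithmeticFunction.zeta ArithmeticFunction.Moebius

namespace Literature.NumberTheory.Sieve

namespace BFI

/-! ### Exponents of a family of scales -/

/-- For positive scales `P i` (`i ∈ G`) with `X' = ∏_G P_i > 1`, the exponents
`e_i = log P_i / log X'` (and `0` off `G`) sum to `1`, and a partial sum `σ = ∑_{i∈s} e_i` satisfies
`∏_{i ∈ s ∩ G} P_i = X'^σ`. [folklore] -/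
theorem exponents_sum {ι : Type*} [Fintype ι] [DecidableEq ι] {G : Finset ι} {P : ι → ℝ}
    (hP : ∀ i ∈ G, 0 < P i) (hX : 1 < ∏ i ∈ G, P i) (s : Finset ι) :
    (∏ i ∈ s.filter (· ∈ G), P i) =
      (∏ i ∈ G, P i) ^ (∑ i ∈ s, if i ∈ G then Real.log (P i) / Real.log (∏ i ∈ G, P i) else 0) := by
  set X : ℝ := ∏ i ∈ G, P i with hXdef
  have hX0 : 0 < X := by linarith
  have hlogX : 0 < Real.log X := Real.log_pos hX
  have hsum : (∑ i ∈ s, if i ∈ G then Real.log (P i) / Real.log X else 0) =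
      (∑ i ∈ s.filter (· ∈ G), Real.log (P i)) / Real.log X := by
    rw [Finset.sum_filter, Finset.sum_div]
    exact Finset.sum_congr rfl fun i _ => by split_ifs <;> simp
  rw [hsum, Real.rpow_def_of_pos hX0, mul_div_cancel₀ _ hlogX.ne', ← Real.log_prod, Real.exp_log]
  · exact Finset.prod_pos fun i hi => hP i (Finset.mem_filter.1 hi).2
  · exact fun i hi => (hP i (Finset.mem_filter.1 hi).2).ne'

/-- The exponents sum to `1`. [folklore] -/
theorem exponents_sum_univ {ι : Type*} [Fintype ι] [DecidableEq ι] {G : Finset ι} {P : ι → ℝ}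
    (hP : ∀ i ∈ G, 0 < P i) (hX : 1 < ∏ i ∈ G, P i) :
    (∑ i, if i ∈ G then Real.log (P i) / Real.log (∏ i ∈ G, P i) else 0) = 1 := by
  have h := exponents_sum hP hX Finset.univ
  have hfil : Finset.univ.filter (· ∈ G) = G := by ext i; simp
  rw [hfil] at h
  -- `X = X^σ` with `X > 1` forces `σ = 1`
  set t := ∑ i, if i ∈ G then Real.log (P i) / Real.log (∏ i ∈ G, P i) else 0
  have h1 : (∏ i ∈ G, P i) ^ (1 : ℝ) = (∏ i ∈ G, P i) ^ t := by rw [Real.rpow_one]; exact h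
  refine le_antisymm ?_ ?_
  · exact (Real.rpow_le_rpow_left_iff hX).1 (le_of_eq h1.symm)
  · exact (Real.rpow_le_rpow_left_iff hX).1 (le_of_eq h1)


/-! ### Grouping a product of pieces into a bilinear form -/

/-- `|∏_{i∈S} f i| ≤ τ^{13}` for at most `13` pieces bounded by `1`. [folklore] -/
theorem abs_prod_pieces_le {ι : Type*} [DecidableEq ι] {G S : Finset ι} {f : ι → ArithmeticFunction ℝ}
    (hSG : S ⊆ G) (hf1 : ∀ i ∈ G, ∀ n, |f i n| ≤ 1) (hcard : S.card ≤ 13) (n : ℕ) :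
    |(∏ i ∈ S, f i) n| ≤ (σ 0 n : ℝ) ^ 13 := by
  have h1 := abs_prod_apply_le_sigma_zero_pow S f (fun i hi m => hf1 i (hSG hi) m) n
  rcases Nat.eq_zero_or_pos n with rfl | hn
  · simp
  · exact h1.trans (pow_le_pow_right₀ (by exact_mod_cast one_le_sigma_zero hn.ne') hcard)

/-- **A grouped product of pieces is a bilinear form with multiplying supports.**  Split the pieces
of `G` into two nonempty groups `T`, `S` (`∏_T f · ∏_S f = ∏_G f`, `∏_T P · ∏_S P = ∏_G P`,
`#T + #S = #G ≤ 14`), with `x ≤ ∏_G P` and `(1+Δ)^{#G} ∏_G P ≤ 2x`, `(1+Δ)^{14} ≤ 2`.  Then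
`α = ∏_T f` lives on `m ∼ M = ∏_T P`, `β = ∏_S f` on `n ∼ N = ∏_S P` (both `z`-rough), the supports
multiply into `(x, 2x]`, and `sievedDisc (∏_G f) q a z x = Δ_{α⋆β}(q)` (`Literature.NumberTheory.Sieve.BFI.bilinDisc`).
[cite: BombieriFriedlanderIwaniecActa1986, §15 p. 245–246] -/
theorem sievedDisc_prod_pieces_eq_bilinDisc {ι : Type*} [DecidableEq ι] {G T S : Finset ι}
    {f : ι → ArithmeticFunction ℝ} {P : ι → ℝ} {Δ z x : ℝ}
    (hP : ∀ i ∈ G, 1 ≤ P i)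
    (hsupp : ∀ i ∈ G, ∀ n : ℕ, f i n ≠ 0 → P i < n ∧ (n : ℝ) ≤ (1 + Δ) * P i ∧ IsRough z n)
    (hTG : T ⊆ G) (hSG : S ⊆ G) (hT : T.Nonempty) (hS : S.Nonempty)
    (hfTS : (∏ i ∈ T, f i) * (∏ i ∈ S, f i) = ∏ i ∈ G, f i)
    (hPTS : (∏ i ∈ T, P i) * (∏ i ∈ S, P i) = ∏ i ∈ G, P i)
    (hcardTS : T.card + S.card = G.card) (hG14 : G.card ≤ 14)
    (hΔ0 : 0 ≤ Δ) (hΔ14 : (1 + Δ) ^ 14 ≤ 2) (hx : 0 ≤ x)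
    (hX1 : x ≤ ∏ i ∈ G, P i) (hX3 : (1 + Δ) ^ G.card * ∏ i ∈ G, P i ≤ 2 * x) :
    (∀ m : ℕ, (∏ i ∈ T, f i) m ≠ 0 → m ∈ dyadic (∏ i ∈ T, P i) ∧ IsRough z m) ∧
    (∀ n : ℕ, (∏ i ∈ S, f i) n ≠ 0 → n ∈ dyadic (∏ i ∈ S, P i) ∧ IsRough z n) ∧
    (∀ m n : ℕ, (∏ i ∈ T, f i) m ≠ 0 → (∏ i ∈ S, f i) n ≠ 0 →
      x < (m : ℝ) * n ∧ (m : ℝ) * n ≤ 2 * x) ∧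
    ∀ (q : ℕ) (a : ℤ), sievedDisc (fun n => (∏ i ∈ G, f i) n) q a z x =
      bilinDisc a (∏ i ∈ T, P i) (∏ i ∈ S, P i) (⇑(∏ i ∈ T, f i)) (⇑(∏ i ∈ S, f i)) q := by
  have h1Δ : 1 ≤ 1 + Δ := by linarith
  have hpowle : ∀ {k : ℕ}, k ≤ 14 → (1 + Δ) ^ k ≤ 2 := fun hk => (pow_le_pow_right₀ h1Δ hk).trans hΔ14
  have hTcard : T.card ≤ 14 := by omega
  have hScard : S.card ≤ 14 := by omega
  have hαs : ∀ m : ℕ, (∏ i ∈ T, f i) m ≠ 0 → m ∈ dyadic (∏ i ∈ T, P i) ∧ IsRough z m :=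
    fun m hm => prod_pieces_support_dyadic hTG hT hP hsupp (hpowle hTcard) hm
  have hβs : ∀ n : ℕ, (∏ i ∈ S, f i) n ≠ 0 → n ∈ dyadic (∏ i ∈ S, P i) ∧ IsRough z n :=
    fun n hn => prod_pieces_support_dyadic hSG hS hP hsupp (hpowle hScard) hn
  have hM0 : 0 ≤ ∏ i ∈ T, P i := zero_le_one.trans (one_le_prod_pieces hTG hP)
  have hN0 : 0 ≤ ∏ i ∈ S, P i := zero_le_one.trans (one_le_prod_pieces hSG hP)
  have hprod : ∀ m n : ℕ, (∏ i ∈ T, f i) m ≠ 0 → (∏ i ∈ S, f i) n ≠ 0 →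
      x < (m : ℝ) * n ∧ (m : ℝ) * n ≤ 2 * x := by
    intro m n hm hn
    obtain ⟨hm1, hm2, -⟩ := prod_pieces_support hTG hT hP hsupp hm
    obtain ⟨hn1, hn2, -⟩ := prod_pieces_support hSG hS hP hsupp hn
    constructor
    · calc x ≤ ∏ i ∈ G, P i := hX1
        _ = (∏ i ∈ T, P i) * (∏ i ∈ S, P i) := hPTS.symm
        _ < (m : ℝ) * n := mul_lt_mul'' hm1 hn1 hM0 hN0
    · calc (m : ℝ) * n ≤ ((1 + Δ) ^ T.card * ∏ i ∈ T, P i) * ((1 + Δ) ^ S.card * ∏ i ∈ S, P i) :=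
            mul_le_mul hm2 hn2 (Nat.cast_nonneg _) (by positivity)
        _ = (1 + Δ) ^ G.card * ∏ i ∈ G, P i := by rw [← hPTS, ← hcardTS, pow_add]; ring
        _ ≤ 2 * x := hX3
  refine ⟨hαs, hβs, hprod, fun q a => ?_⟩
  rw [← hfTS]
  exact sievedDisc_eq_bilinDisc hx hM0 hN0 hαs hβs hprod q a


/-! ### The bound for a family of genuine pieces -/

/-- The large-`x` facts used by `genuine_pieces_bound` (one existential witness). [folklore] -/
theorem eventually_genuine (x₁ x₂ x₃ x₄ x₅ x₆ : ℝ) :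
    ∃ x₀ : ℝ, ∀ x : ℝ, x₀ ≤ x → x₁ ≤ x ∧ x₂ ≤ x ∧ x₃ ≤ x ∧ x₄ ≤ x ∧ x₅ ≤ x ∧ x₆ ≤ x ∧
      Real.exp 10 ≤ x := by
  refine ⟨max x₁ (max x₂ (max x₃ (max x₄ (max x₅ (max x₆ (Real.exp 10)))))), fun x hx => ?_⟩
  simp only [max_le_iff] at hx
  obtain ⟨h1, h2, h3, h4, h5, h6, h7⟩ := hx
  exact ⟨h1, h2, h3, h4, h5, h6, h7⟩

/-- **The interior pieces, grouped and dispatched (BFI §17, p. 249).**  Let `f i` (`i ∈ G`,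
`#G ≤ 14`) be nonzero pieces bounded by `1`, supported in the boxes `(P_i, (1+Δ)P_i]` (`P_i ≥ 1`)
on `z`-rough integers, `z = exp(√log x)`, each either a sieved box indicator (`roughBoxOne`) or a
sieved, boxed Möbius function with `P_i < U ≤ 4x^{1/7}` (`roughBoxMoebius`); let
`X' = ∏ P_i ∈ [x, 2^{15}x]` with `(1+Δ)^{#G} X' ≤ 2x`, `(1+Δ)^{14} ≤ 2`, `Δ ≤ 1/2`, and let `λ` be
well factorable of level `x^{4/7−ε}`.  With the exponents `e_i = log P_i / log X'` (summing to `1`)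
the dichotomy `exists_subsum_mem_Icc_or` (`a = 3/14 − ε/2 + ε/200`, `b = 2a = 3/7 − ε + ε/100`)
gives either a partial product `N = X'^s`, `a ≤ s ≤ b` — Case A: `sparse_bound`, or (A₂) by
`siegelWalfiszHyp_prod_pieces` and `caseA1_bound` / `caseA2_bound` — or a single piece of exponent
`> b`, necessarily a box indicator (the Möbius pieces have exponent `< 1/7 + o(1)`) — Case B:
`caseB1_bound` / `caseB2_bound`.  Conclusion:
`|∑_{d ≤ x^{4/7−ε}, (d,a)=1} λ(d) · sievedDisc (∏_G f) d a z x| ≤ C x (log x)^{−A₅}` for `x ≥ x₀`.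
[cite: BombieriFriedlanderIwaniecActa1986, §17 p. 249] -/
theorem genuine_pieces_bound
    (h1 : BombieriFriedlanderIwaniecTheorem1) (h2 : BombieriFriedlanderIwaniecTheorem2)
    (h0b : BombieriFriedlanderIwaniecTheorem0b) (h5 : BombieriFriedlanderIwaniecTheorem5StarInterval)
    (hL3 : BombieriFriedlanderIwaniecLemma3) (hShiu : Shiu1980BrunTitchmarsh)
    (hSWμ : LFunctions.SiegelWalfiszMoebius) (hFL : SieveSequence.fundamental_lemma_uniform)
    {a : ℤ} (ha : a ≠ 0) {ε : ℝ} (hε : 0 < ε) (hε' : ε ≤ 1 / 1000) {A₅ : ℝ} (hA₅ : 0 ≤ A₅) :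
    ∃ C x₀ : ℝ, 0 ≤ C ∧ ∀ x : ℝ, x₀ ≤ x →
      ∀ {ι : Type} [Fintype ι] [DecidableEq ι] (G : Finset ι) (f : ι → ArithmeticFunction ℝ)
        (P : ι → ℝ) (Δ : ℝ) (U : ℕ) (lam : ℕ → ℝ),
      IsWellFactorable (x ^ (4 / 7 - ε)) lam →
      0 < Δ → Δ ≤ 1 / 2 → (1 + Δ) ^ 14 ≤ 2 → G.card ≤ 14 → (U : ℝ) ≤ 4 * x ^ (1 / 7 : ℝ) →
      (∀ i ∈ G, 1 ≤ P i) → (∀ i ∈ G, ∀ n, |f i n| ≤ 1) →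
      (∀ i ∈ G, ∀ n : ℕ, f i n ≠ 0 →
        P i < n ∧ (n : ℝ) ≤ (1 + Δ) * P i ∧ IsRough (Real.exp (Real.sqrt (Real.log x))) n) →
      (∀ i ∈ G, f i ≠ 0) →
      (∀ i ∈ G,
        (⇑(f i) = roughBoxOne (Real.exp (Real.sqrt (Real.log x))) ⌊P i⌋₊ ⌊(1 + Δ) * P i⌋₊ ∧
          ∀ n : ℕ, n ≠ 0 → f i n = if P i < n ∧ (n : ℝ) ≤ (1 + Δ) * P i then
            (if IsRough (Real.exp (Real.sqrt (Real.log x))) n then 1 else 0) else 0) ∨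
        (P i < U ∧ ⇑(f i) = roughBoxMoebius (Real.exp (Real.sqrt (Real.log x))) ⌊P i⌋₊
          (min ⌊(1 + Δ) * P i⌋₊ U))) →
      x ≤ ∏ i ∈ G, P i → (∏ i ∈ G, P i) ≤ 2 ^ 15 * x →
      (1 + Δ) ^ G.card * ∏ i ∈ G, P i ≤ 2 * x →
      |∑ d ∈ (Icc 1 ⌊x ^ (4 / 7 - ε)⌋₊).filter (fun d : ℕ => IsCoprime (d : ℤ) a),
          lam d * sievedDisc (fun n => (∏ i ∈ G, f i) n) d a (Real.exp (Real.sqrt (Real.log x))) x| ≤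
        C * x / Real.log x ^ A₅ := by
  -- constants
  obtain ⟨cD, Cs, xs, hcD, hCs, hsp⟩ := sparse_bound hL3 ha hε hA₅
  have hOne : ∀ A₁ A₂ : ℝ, ∃ C : ℝ, 0 < A₁ → 0 < A₂ → (0 < C ∧ ∀ (z Nh : ℝ) (Y₁ Y₂ : ℕ),
      2 ≤ z → z ≤ Real.sqrt Nh → Real.log z ≤ 12 * Real.sqrt (Real.log Nh) → 3 ≤ Nh → Nh ≤ Y₁ →
      (Y₂ : ℝ) ≤ 2 * Nh → SWAbs (roughBoxOne z Y₁ Y₂) Nh A₁ A₂ C) := by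
    intro A₁ A₂
    by_cases hA : 0 < A₁ ∧ 0 < A₂
    · obtain ⟨C, hC, h⟩ := swabs_roughBoxOne hFL (K := 12) (by norm_num) hA.1 hA.2
      exact ⟨C, fun _ _ => ⟨hC, h⟩⟩
    · exact ⟨1, fun h1' h2' => absurd ⟨h1', h2'⟩ hA⟩
  choose Cone hCone using hOne
  have hMo : ∀ A₁ A₂ : ℝ, ∃ C : ℝ, 0 < A₁ → 0 < A₂ → (0 < C ∧ ∀ (z Nh : ℝ) (Y₁ Y₂ : ℕ),
      8 ≤ z → Real.log z ≤ 12 * Real.sqrt (Real.log Nh) → Real.exp 16 ≤ Nh → Nh ≤ Y₁ → Y₁ ≤ Y₂ →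
      (Y₂ : ℝ) ≤ 2 * Nh → SWAbs (roughBoxMoebius z Y₁ Y₂) Nh A₁ A₂ C) := by
    intro A₁ A₂
    by_cases hA : 0 < A₁ ∧ 0 < A₂
    · obtain ⟨C, hC, h⟩ := swabs_roughBoxMoebius hSWμ (K := 12) (by norm_num) hA.1 hA.2
      exact ⟨C, fun _ _ => ⟨hC, h⟩⟩
    · exact ⟨1, fun h1' h2' => absurd ⟨h1', h2'⟩ hA⟩
  choose Cmo hCmo using hMo
  set Ch : ℝ → ℝ → ℝ := fun A₁ A₂ => max (Cone A₁ A₂) (Cmo A₁ A₂) with hChdef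
  have hCh1 : ∀ A₁ A₂ : ℝ, 0 < A₁ → 0 < A₂ → ∀ (z Nh : ℝ) (Y₁ Y₂ : ℕ), 2 ≤ z → z ≤ Real.sqrt Nh →
      Real.log z ≤ 12 * Real.sqrt (Real.log Nh) → 3 ≤ Nh → Nh ≤ Y₁ → (Y₂ : ℝ) ≤ 2 * Nh →
      SWAbs (roughBoxOne z Y₁ Y₂) Nh A₁ A₂ (Ch A₁ A₂) :=
    fun A₁ A₂ hA₁ hA₂ z Nh Y₁ Y₂ hz hzN hlz hN3 hY1 hY2 =>
      ((hCone A₁ A₂ hA₁ hA₂).2 z Nh Y₁ Y₂ hz hzN hlz hN3 hY1 hY2).mono (le_max_left _ _) (by linarith)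
  have hCh2 : ∀ A₁ A₂ : ℝ, 0 < A₁ → 0 < A₂ → ∀ (z Nh : ℝ) (Y₁ Y₂ : ℕ), 8 ≤ z →
      Real.log z ≤ 12 * Real.sqrt (Real.log Nh) → Real.exp 16 ≤ Nh → Nh ≤ Y₁ → Y₁ ≤ Y₂ →
      (Y₂ : ℝ) ≤ 2 * Nh → SWAbs (roughBoxMoebius z Y₁ Y₂) Nh A₁ A₂ (Ch A₁ A₂) :=
    fun A₁ A₂ hA₁ hA₂ z Nh Y₁ Y₂ hz hlz hN16 hY1 hY12 hY2 =>
      ((hCmo A₁ A₂ hA₁ hA₂).2 z Nh Y₁ Y₂ hz hlz hN16 hY1 hY12 hY2).mono (le_max_right _ _)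
        (le_trans (by have := Real.add_one_le_exp (16:ℝ); linarith) hN16)
  obtain ⟨Csw, hCsw⟩ := siegelWalfiszHyp_of_dense hShiu Ch 12 hcD (K := 14) (by norm_num)
  obtain ⟨C₁, x₁, hC₁, hA1⟩ := caseA1_bound h1 ha hε hε' hA₅ Csw
  obtain ⟨C₂, x₂, hC₂, hA2⟩ := caseA2_bound h2 h0b hL3 ha hε hε' hA₅ Csw hcD
  obtain ⟨C₃, x₃, hC₃, hB1⟩ := caseB1_bound h5 ha hε hε' hA₅
  obtain ⟨C₄, x₄, hC₄, hB2⟩ := caseB2_bound hFL a hε hε' hA₅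
  obtain ⟨x₅, hx₅⟩ := eventually_sw
  obtain ⟨x₀, hx₀⟩ := eventually_genuine xs x₁ x₂ x₃ x₄ x₅
  refine ⟨Cs + C₁ + C₂ + C₃ + C₄, x₀, by positivity, ?_⟩
  intro x hx ι _ _ G f P Δ U lam hlam hΔ0 hΔ2 hΔ14 hG14 hU hP hf1 hsupp hne htype hX1 hX2 hX3
  obtain ⟨hxs, hx₁, hx₂, hx₃, hx₄, hx₅', hxe⟩ := hx₀ x hx
  set z : ℝ := Real.exp (Real.sqrt (Real.log x)) with hz
  set X' : ℝ := ∏ i ∈ G, P i with hX'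
  set L : ℝ := Real.log x with hL
  -- basic sizes
  have hx0 : 0 < x := (Real.exp_pos 10).trans_le hxe
  have hL10 : 10 ≤ L := by rw [hL, Real.le_log_iff_exp_le hx0]; exact hxe
  have hx1 : (1 : ℝ) < x := by
    have : (1 : ℝ) < Real.exp 10 := by have := Real.add_one_le_exp (10:ℝ); linarith
    linarith
  have hX'1 : (1 : ℝ) < X' := hx1.trans_le hX1
  have hX'0 : 0 < X' := by linarith
  have hLX : L ≤ Real.log X' := Real.log_le_log hx0 hX1
  have hlogX'0 : 0 < Real.log X' := by linarith
  have hP0 : ∀ i ∈ G, 0 < P i := fun i hi => zero_lt_one.trans_le (hP i hi)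
  have hlam1 : ∀ n, |lam n| ≤ 1 := hlam.1
  have hΔ13 : (1 + Δ) ^ 13 ≤ 2 := (pow_le_pow_right₀ (by linarith) (by norm_num)).trans hΔ14
  have hbound0 : ∀ {C' : ℝ}, 0 ≤ C' → C' ≤ Cs + C₁ + C₂ + C₃ + C₄ →
      ∀ {v : ℝ}, v ≤ C' * x / Real.log x ^ A₅ → v ≤ (Cs + C₁ + C₂ + C₃ + C₄) * x / Real.log x ^ A₅ := by
    intro C' hC' hle v hv
    refine hv.trans ?_
    have : 0 ≤ x / Real.log x ^ A₅ := div_nonneg hx0.le (Real.rpow_nonneg (by linarith) _)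
    calc C' * x / Real.log x ^ A₅ = C' * (x / Real.log x ^ A₅) := by ring
      _ ≤ (Cs + C₁ + C₂ + C₃ + C₄) * (x / Real.log x ^ A₅) := mul_le_mul_of_nonneg_right hle this
      _ = _ := by ring
  -- exponents
  set e : ι → ℝ := fun i => if i ∈ G then Real.log (P i) / Real.log X' else 0 with he
  have hesum : ∑ i, e i = 1 := exponents_sum_univ hP0 hX'1
  set a₀ : ℝ := 3 / 14 - ε / 2 + ε / 200 with ha₀
  have ha₀pos : 0 < a₀ := by rw [ha₀]; linarith
  have ha₀5 : 1 / 5 ≤ a₀ := by rw [ha₀]; linarith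
  have h2a₀ : 2 * a₀ = 3 / 7 - ε + ε / 100 := by rw [ha₀]; ring
  rcases exists_subsum_mem_Icc_or e ha₀pos (le_refl (2 * a₀)) with ⟨s, hs1, hs2⟩ | ⟨hsmall, hbig⟩
  · ----------------------------------------------------------------
    -- Case A: a partial product `N = X'^t`, `a₀ ≤ t ≤ 2 a₀`
    ----------------------------------------------------------------
    set S : Finset ι := s.filter (· ∈ G) with hSdef
    set T : Finset ι := G.filter (· ∉ S) with hTdef
    set t : ℝ := ∑ i ∈ s, e i with ht
    have hSG : S ⊆ G := fun i hi => (Finset.mem_filter.1 hi).2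
    have hTG : T ⊆ G := Finset.filter_subset _ _
    have hNt : (∏ i ∈ S, P i) = X' ^ t := exponents_sum hP0 hX'1 s
    have hGS : G.filter (· ∈ S) = S := by
      ext i; simp only [Finset.mem_filter, hSdef]; tauto
    have hfTS : (∏ i ∈ T, f i) * (∏ i ∈ S, f i) = ∏ i ∈ G, f i := by
      have h := Finset.prod_filter_mul_prod_filter_not G (· ∈ S) f
      rw [hGS] at h
      rw [mul_comm]; exact h
    have hPTS : (∏ i ∈ T, P i) * (∏ i ∈ S, P i) = X' := by
      have h := Finset.prod_filter_mul_prod_filter_not G (· ∈ S) P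
      rw [hGS] at h
      rw [mul_comm]; exact h
    have hcardTS : T.card + S.card = G.card := by
      have h := Finset.card_filter_add_card_filter_not (s := G) (· ∈ S)
      rw [hGS] at h
      rw [add_comm]; exact h
    -- `S` and `T` are nonempty
    have ht_a : a₀ ≤ t := hs1
    have ht_b : t ≤ 2 * a₀ := hs2
    have hSne : S.Nonempty := by
      by_contra hS
      rw [Finset.not_nonempty_iff_eq_empty] at hS
      rw [hS, Finset.prod_empty] at hNt
      have : t = 0 := by
        have h1 : X' ^ (0 : ℝ) = X' ^ t := by rw [Real.rpow_zero]; exact hNt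
        exact le_antisymm ((Real.rpow_le_rpow_left_iff hX'1).1 (le_of_eq h1.symm))
          ((Real.rpow_le_rpow_left_iff hX'1).1 (le_of_eq h1))
      linarith only [this, ht_a, ha₀pos]
    have hTne : T.Nonempty := by
      by_contra hT
      rw [Finset.not_nonempty_iff_eq_empty] at hT
      have hPTS' := hPTS
      rw [hT, Finset.prod_empty, one_mul] at hPTS'
      rw [hPTS'] at hNt
      have : t = 1 := by
        have h1 : X' ^ (1 : ℝ) = X' ^ t := by rw [Real.rpow_one]; exact hNt
        exact le_antisymm ((Real.rpow_le_rpow_left_iff hX'1).1 (le_of_eq h1.symm))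
          ((Real.rpow_le_rpow_left_iff hX'1).1 (le_of_eq h1))
      have h2 : 2 * a₀ < 1 := by rw [ha₀]; linarith only [hε, hε']
      linarith only [this, ht_b, h2]
    have hScard : S.card ≤ 13 := by have := hTne.card_pos; omega
    have hTcard : T.card ≤ 13 := by have := hSne.card_pos; omega
    -- the bilinear form
    obtain ⟨hαs, hβs, -, hsd⟩ := sievedDisc_prod_pieces_eq_bilinDisc hP hsupp hTG hSG hTne hSne hfTS
      hPTS hcardTS hG14 hΔ0.le hΔ14 hx0.le hX1 hX3
    have hαb : ∀ m, |(∏ i ∈ T, f i) m| ≤ (σ 0 m : ℝ) ^ 13 := abs_prod_pieces_le hTG hf1 hTcard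
    have hβb : ∀ n, |(∏ i ∈ S, f i) n| ≤ (σ 0 n : ℝ) ^ 13 := abs_prod_pieces_le hSG hf1 hScard
    have hαs' : ∀ m, (∏ i ∈ T, f i) m ≠ 0 → m ∈ dyadic (∏ i ∈ T, P i) := fun m hm => (hαs m hm).1
    have hβs' : ∀ n, (∏ i ∈ S, f i) n ≠ 0 → n ∈ dyadic (∏ i ∈ S, P i) := fun n hn => (hβs n hn).1
    have hβr : ∀ n, (∏ i ∈ S, f i) n ≠ 0 → IsRough z n := fun n hn => (hβs n hn).2
    have hsum : ∑ d ∈ (Icc 1 ⌊x ^ (4 / 7 - ε)⌋₊).filter (fun d : ℕ => IsCoprime (d : ℤ) a),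
        lam d * sievedDisc (fun n => (∏ i ∈ G, f i) n) d a z x =
        ∑ d ∈ (Icc 1 ⌊x ^ (4 / 7 - ε)⌋₊).filter (fun d : ℕ => IsCoprime (d : ℤ) a),
          lam d * bilinDisc a (∏ i ∈ T, P i) (∏ i ∈ S, P i) (⇑(∏ i ∈ T, f i)) (⇑(∏ i ∈ S, f i)) d :=
      Finset.sum_congr rfl fun d _ => by rw [hsd d a]
    rw [hsum]
    have ht1 : 1 / 5 ≤ t := ha₀5.trans ht_a
    have ht2 : t ≤ 9 / 20 := by
      have : 2 * a₀ ≤ 9 / 20 := by rw [ha₀]; linarith only [hε, hε']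
      exact ht_b.trans this
    by_cases hd : l2Sq (∏ i ∈ S, P i) (⇑(∏ i ∈ S, f i)) * Real.log (2 * ∏ i ∈ S, P i) ^ cD < ∏ i ∈ S, P i
    · -- sparse
      exact hbound0 hCs (by linarith only [hC₁, hC₂, hC₃, hC₄])
        (hsp x hxs X' _ _ t _ _ lam hlam1 hX1 hX2 hPTS hNt ht1 ht2 hαb hαs' hβs' hd)
    · -- dense: hypothesis (A₂) from the piece of the largest box
      have hdense : (∏ i ∈ S, P i) ≤ Real.log (2 * ∏ i ∈ S, P i) ^ cD *
          l2Sq (∏ i ∈ S, P i) (⇑(∏ i ∈ S, f i)) := by rw [mul_comm]; exact not_lt.1 hd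
      obtain ⟨i₀, hi₀, hmax⟩ := S.exists_max_image P hSne
      -- the size of the largest box: `P i₀ ≥ N^{1/13} ≥ x^{a₀/13}`
      have hc1 : 1 / 100 ≤ a₀ / 13 := by linarith only [ha₀5]
      have hc2 : a₀ / 13 ≤ 1 := by
        have : a₀ ≤ 1 := by rw [ha₀]; linarith only [hε, hε']
        linarith only [this]
      obtain ⟨hbig', hzP', hlogz'⟩ := hx₅ x hx₅' (a₀ / 13) hc1 hc2
      have hPi₀ : x ^ (a₀ / 13) ≤ P i₀ := by
        have h13 := rpow_inv_thirteen_le_max (fun i hi => hP i (hSG hi)) hScard hi₀ hmax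
        refine le_trans ?_ h13
        rw [show (∏ i ∈ S, P i) = X' ^ t from hNt, ← Real.rpow_mul hX'0.le]
        calc x ^ (a₀ / 13) ≤ X' ^ (a₀ / 13) := Real.rpow_le_rpow hx0.le hX1 (by linarith only [ha₀pos])
          _ ≤ X' ^ (t * (1 / 13)) := Real.rpow_le_rpow_of_exponent_le hX'1.le (by linarith only [ht_a])
      have hbigP : Real.exp 16 + 1 ≤ P i₀ := hbig'.trans hPi₀
      have hz8 : 8 ≤ z := by
        have h3 : (3 : ℝ) ≤ Real.sqrt L := by
          rw [show (3:ℝ) = Real.sqrt 9 by rw [show (9:ℝ) = 3 ^ 2 by norm_num, Real.sqrt_sq (by norm_num)]]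
          exact Real.sqrt_le_sqrt (by linarith only [hL10])
        have h4 : Real.exp 3 ≤ z := Real.exp_le_exp.2 h3
        have h5 : (8 : ℝ) ≤ Real.exp 3 := by
          have h7 : (2 : ℝ) ≤ Real.exp 1 := by have := Real.add_one_le_exp (1:ℝ); norm_num at this; linarith
          have h6 : Real.exp 3 = Real.exp 1 ^ 3 := by rw [← Real.exp_nat_mul]; norm_num
          rw [h6]
          calc (8 : ℝ) = 2 ^ 3 := by norm_num
            _ ≤ Real.exp 1 ^ 3 := pow_le_pow_left₀ (by norm_num) h7 3
        exact h5.trans h4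
      have hzP : z ^ 2 ≤ P i₀ / 2 := hzP'.trans (by linarith only [hPi₀])
      have hlogz : Real.log z ≤ 12 * Real.sqrt (Real.log (P i₀ / 2)) := by
        rw [hz, Real.log_exp]
        refine hlogz'.trans (mul_le_mul_of_nonneg_left (Real.sqrt_le_sqrt ?_) (by norm_num))
        have hxc0 : 0 < x ^ (a₀ / 13) / 2 := by positivity
        exact Real.log_le_log hxc0 (by linarith only [hPi₀])
      have htype' : ∀ i ∈ G, (⇑(f i) = roughBoxOne z ⌊P i⌋₊ ⌊(1 + Δ) * P i⌋₊) ∨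
          (P i < U ∧ ⇑(f i) = roughBoxMoebius z ⌊P i⌋₊ (min ⌊(1 + Δ) * P i⌋₊ U)) := by
        intro i hi
        rcases htype i hi with ⟨h1', -⟩ | h2'
        · exact Or.inl h1'
        · exact Or.inr h2'
      have hsw : SiegelWalfiszHyp (∏ i ∈ S, P i) 2 Csw ⇑(∏ i ∈ S, f i) :=
        siegelWalfiszHyp_prod_pieces hCh1 hCh2 hCsw hP hf1 hsupp htype' hSG hScard hΔ0.le hΔ2 hΔ13 hi₀ hmax
          hbigP hz8 hzP hlogz hdense
      have htb : t ≤ 3 / 7 - ε + ε / 100 := by rw [← h2a₀]; exact ht_b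
      by_cases h27 : 2 / 7 - 3 / 2 * ε ≤ t
      · exact hbound0 hC₁ (by linarith only [hCs, hC₂, hC₃, hC₄])
          (hA1 x hx₁ X' _ _ t z _ _ lam hlam hX1 hX2 hPTS hNt h27 htb le_rfl hαb hβb hβr hsw)
      · have hta : 3 / 14 - ε / 2 + ε / 200 ≤ t := by rw [← ha₀]; exact ht_a
        exact hbound0 hC₂ (by linarith only [hCs, hC₁, hC₃, hC₄])
          (hA2 x hx₂ X' _ _ t z _ _ lam hlam hX1 hX2 hPTS hNt hta (le_of_lt (not_le.1 h27)) le_rfl hαb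
            hαs' hβb hβs' hβr hsw hdense)
  · ----------------------------------------------------------------
    -- Case B: one piece of exponent `> 2 a₀`
    ----------------------------------------------------------------
    obtain ⟨i₀, hi₀a⟩ : ∃ i, a₀ ≤ e i := by
      by_contra hno
      push Not at hno
      have hfil : Finset.univ.filter (fun i => e i < a₀) = Finset.univ := by
        ext i; simp [hno i]
      rw [hfil, hesum] at hsmall
      have : a₀ < 1 := by rw [ha₀]; linarith only [hε, hε']
      linarith only [hsmall, this]
    have hb₀ : 2 * a₀ < e i₀ := hbig i₀ hi₀a
    have hi₀G : i₀ ∈ G := by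
      by_contra hni
      have : e i₀ = 0 := by simp [he, hni]
      linarith only [this, hb₀, ha₀pos]
    have hei₀ : e i₀ = Real.log (P i₀) / Real.log X' := by simp [he, hi₀G]
    have hPi₀1 : 1 ≤ P i₀ := hP i₀ hi₀G
    have hPi₀0 : 0 < P i₀ := by linarith only [hPi₀1]
    have hlog2 : Real.log 2 < 0.6931471808 := Real.log_two_lt_d9
    -- the piece is a box indicator: a Möbius piece has exponent `< 1/7 + log 2 / L`
    have hform : ∀ n : ℕ, n ≠ 0 → f i₀ n = if P i₀ < n ∧ (n : ℝ) ≤ (1 + Δ) * P i₀ then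
        (if IsRough z n then 1 else 0) else 0 := by
      rcases htype i₀ hi₀G with ⟨-, hform⟩ | ⟨hPU, -⟩
      · exact hform
      · exfalso
        have hlt : Real.log (P i₀) < 2 * Real.log 2 + L / 7 := by
          have h1 : Real.log (P i₀) < Real.log (4 * x ^ (1 / 7 : ℝ)) :=
            Real.log_lt_log hPi₀0 (hPU.trans_le hU)
          rw [Real.log_mul (by norm_num) (Real.rpow_pos_of_pos hx0 _).ne', Real.log_rpow hx0, ← hL,
            show (4 : ℝ) = 2 ^ 2 by norm_num, Real.log_pow] at h1
          push_cast at h1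
          linarith only [h1]
        have hlogP0 : 0 ≤ Real.log (P i₀) := Real.log_nonneg hPi₀1
        have hL0 : 0 < L := by linarith only [hL10]
        have he_le : e i₀ ≤ Real.log (P i₀) / L := by
          rw [hei₀]; exact div_le_div_of_nonneg_left hlogP0 hL0 hLX
        have he_lt : e i₀ < (2 * Real.log 2 + L / 7) / L :=
          lt_of_le_of_lt he_le (div_lt_div_of_pos_right hlt hL0)
        have hfrac : (2 * Real.log 2 + L / 7) / L ≤ 0.14 + 1 / 7 := by
          rw [div_le_iff₀ hL0]; nlinarith only [hlog2, hL10]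
        have h2a : (0.4 : ℝ) ≤ 2 * a₀ := by rw [ha₀]; linarith only [hε, hε']
        linarith only [hb₀, he_lt, hfrac, h2a]
    -- the scale `M = P i₀ = X'^{e i₀}`
    have hMτ : P i₀ = X' ^ (e i₀) := by
      have h := exponents_sum hP0 hX'1 {i₀}
      rw [Finset.sum_singleton] at h
      have hfil : ({i₀} : Finset ι).filter (· ∈ G) = {i₀} := by
        ext i; simp only [Finset.mem_filter, Finset.mem_singleton]
        constructor
        · exact fun h => h.1
        · intro h; exact ⟨h, h ▸ hi₀G⟩
      rw [hfil, Finset.prod_singleton] at h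
      rw [he]; exact h
    have hM37 : X' ^ (3 / 7 - ε) < P i₀ := by
      rw [hMτ]
      refine Real.rpow_lt_rpow_of_exponent_lt hX'1 ?_
      have : 3 / 7 - ε < 2 * a₀ := by rw [h2a₀]; linarith only [hε]
      exact this.trans hb₀
    have hFform : ∀ m ∈ dyadic (P i₀), f i₀ m = if P i₀ < m ∧ (m : ℝ) ≤ (1 + Δ) * P i₀ then
        (if IsRough z m then 1 else 0) else 0 :=
      fun m hm => hform m (pos_of_mem_dyadic hPi₀0.le hm).ne'
    have hP' : P i₀ ≤ (1 + Δ) * P i₀ := by nlinarith only [hΔ0, hPi₀0]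
    have h2M : (1 + Δ) * P i₀ ≤ 2 * P i₀ := by nlinarith only [hΔ2, hPi₀0]
    set T : Finset ι := G.erase i₀ with hTdef
    have hTG : T ⊆ G := Finset.erase_subset _ _
    have hfT : f i₀ * ∏ i ∈ T, f i = ∏ i ∈ G, f i := Finset.mul_prod_erase G f hi₀G
    have hPT : P i₀ * ∏ i ∈ T, P i = X' := Finset.mul_prod_erase G P hi₀G
    have hcardT : T.card + 1 = G.card := Finset.card_erase_add_one hi₀G
    have hMX : P i₀ ≤ X' := by
      have h1 : 1 ≤ ∏ i ∈ T, P i := one_le_prod_pieces hTG hP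
      calc P i₀ = P i₀ * 1 := (mul_one _).symm
        _ ≤ P i₀ * ∏ i ∈ T, P i := mul_le_mul_of_nonneg_left h1 hPi₀0.le
        _ = X' := hPT
    have hi₀sub : ({i₀} : Finset ι) ⊆ G := by
      intro i hi; rw [Finset.mem_singleton] at hi; rw [hi]; exact hi₀G
    rcases T.eq_empty_or_nonempty with hT | hTne
    · -- `G = {i₀}`: the cofactor is the unit; necessarily Case B2
      have hfG : ∏ i ∈ G, f i = f i₀ * 1 := by rw [← hfT, hT, Finset.prod_empty]
      have hXM : X' = P i₀ := by rw [← hPT, hT, Finset.prod_empty, mul_one]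
      have hG1 : G.card = 1 := by rw [← hcardT, hT, Finset.card_empty]
      have hBlt : X' ^ (1 - ε / 100) < P i₀ := by
        rw [← hXM]
        calc X' ^ (1 - ε / 100) < X' ^ (1 : ℝ) := Real.rpow_lt_rpow_of_exponent_lt hX'1 (by linarith only [hε])
          _ = X' := Real.rpow_one X'
      have hαs1 : ∀ m : ℕ, f i₀ m ≠ 0 → m ∈ dyadic (P i₀) ∧ IsRough z m := by
        intro m hm
        obtain ⟨h1, h2, h3⟩ := hsupp i₀ hi₀G m hm
        exact ⟨(mem_dyadic hPi₀0.le).2 ⟨h1, h2.trans h2M⟩, h3⟩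
      have hβs1 : ∀ n : ℕ, (1 : ArithmeticFunction ℝ) n ≠ 0 → n ∈ dyadic (1 / 2 : ℝ) ∧ IsRough z n := by
        intro n hn
        have hn1 : n = 1 := by
          by_contra h; exact hn (ArithmeticFunction.one_apply_ne h)
        subst hn1
        refine ⟨(mem_dyadic (by norm_num)).2 ⟨by norm_num, by norm_num⟩, fun p hp => by simp at hp⟩
      have hprod1 : ∀ m n : ℕ, f i₀ m ≠ 0 → (1 : ArithmeticFunction ℝ) n ≠ 0 →
          x < (m : ℝ) * n ∧ (m : ℝ) * n ≤ 2 * x := by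
        intro m n hm hn
        have hn1 : n = 1 := by
          by_contra h; exact hn (ArithmeticFunction.one_apply_ne h)
        subst hn1
        obtain ⟨h1, h2, -⟩ := hsupp i₀ hi₀G m hm
        rw [Nat.cast_one, mul_one]
        refine ⟨by linarith only [hX1, hXM, h1], h2.trans ?_⟩
        rw [hG1, pow_one, hXM] at hX3
        exact hX3
      have hsd1 : ∀ d : ℕ, sievedDisc (fun n => (∏ i ∈ G, f i) n) d a z x =
          bilinDisc a (P i₀) (1 / 2) (⇑(f i₀)) (⇑(1 : ArithmeticFunction ℝ)) d := by
        intro d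
        rw [hfG]
        exact sievedDisc_eq_bilinDisc hx0.le hPi₀0.le (by norm_num) hαs1 hβs1 hprod1 d a
      rw [Finset.sum_congr rfl fun d _ => by rw [hsd1 d]]
      have hone : ∀ n ∈ dyadic (1 / 2 : ℝ), |(1 : ArithmeticFunction ℝ) n| ≤ 1 := by
        intro n _
        rw [ArithmeticFunction.one_apply]
        split_ifs <;> simp
      exact hbound0 hC₄ (by linarith only [hCs, hC₁, hC₂, hC₃])
        (hB2 x hx₄ X' (P i₀) (1 / 2) (P i₀) ((1 + Δ) * P i₀) _ _ lam hlam1 hX1 hX2 hBlt hMX le_rfl hP' h2M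
          hFform (Or.inr ⟨rfl, hXM.symm, hone⟩))
    · -- `T` nonempty: `β = ∏_T f` on `n ∼ ∏_T P`
      have hTcard : T.card ≤ 13 := by omega
      obtain ⟨-, hβs, -, hsd⟩ := sievedDisc_prod_pieces_eq_bilinDisc hP hsupp hi₀sub hTG
        (Finset.singleton_nonempty _) hTne (by rw [Finset.prod_singleton]; exact hfT)
        (by rw [Finset.prod_singleton]; exact hPT) (by rw [Finset.card_singleton]; omega) hG14 hΔ0.le hΔ14
        hx0.le hX1 hX3
      simp only [Finset.prod_singleton] at hsd
      rw [Finset.sum_congr rfl fun d _ => by rw [hsd d a]]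
      have hβb : ∀ n, |(∏ i ∈ T, f i) n| ≤ (σ 0 n : ℝ) ^ 13 := abs_prod_pieces_le hTG hf1 hTcard
      have hN1 : 1 ≤ ∏ i ∈ T, P i := one_le_prod_pieces hTG hP
      by_cases hB : P i₀ ≤ X' ^ (1 - ε / 100)
      · -- Case B1: Theorem 5*
        exact hbound0 hC₃ (by linarith only [hCs, hC₁, hC₂, hC₄])
          (hB1 x hx₃ X' (P i₀) (∏ i ∈ T, P i) (P i₀) ((1 + Δ) * P i₀) z _ _ lam hlam hX1 hX2 hPT hM37 hB
            le_rfl hFform hβb)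
      · -- Case B2: the fundamental lemma
        have hBlt : X' ^ (1 - ε / 100) < P i₀ := not_le.1 hB
        exact hbound0 hC₄ (by linarith only [hCs, hC₁, hC₂, hC₃])
          (hB2 x hx₄ X' (P i₀) (∏ i ∈ T, P i) (P i₀) ((1 + Δ) * P i₀) _ _ lam hlam1 hX1 hX2 hBlt hMX le_rfl
            hP' h2M hFform (Or.inl ⟨hN1, hPT, hβb⟩))


/-! ### From an interior box-tuple to the genuine pieces -/

/-- The sifted dyadic discrepancy of the zero sequence vanishes. [folklore] -/
theorem sievedDisc_zero (q : ℕ) (a : ℤ) (z x : ℝ) : sievedDisc (fun _ => (0 : ℝ)) q a z x = 0 := by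
  unfold sievedDisc; simp

/-- **The interior box-tuples (BFI §15 p. 245–246 with §17 p. 249).**  For an interior tuple `κ`
of boxes (product box inside `(x, 2x]`) of a Heath-Brown piece with `1 ≤ j ≤ 7`, truncation
`1 ≤ U ≤ 4x^{1/7}`, box ratio `1 + Δ` with `(1+Δ)^{14} ≤ 2`, `Δ ≤ 1/2`, sifting level
`z = exp(√log x)`, and `λ` well factorable of level `x^{4/7−ε}`:
`|∑_{d ≤ x^{4/7−ε}, (d,a)=1} λ(d) · sievedDisc (PMain κ) d a z x| ≤ C x (log x)^{−A₅}` for `x ≥ x₀`.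
The factors whose box lies below `1` are Dirichlet units (`factorMain_eq_one`) and are discarded;
the remaining ("genuine") factors form a family as in `genuine_pieces_bound`.
[cite: BombieriFriedlanderIwaniecActa1986, §15 p. 245–246; §17 p. 249] -/
theorem interior_tuple_bound
    (h1 : BombieriFriedlanderIwaniecTheorem1) (h2 : BombieriFriedlanderIwaniecTheorem2)
    (h0b : BombieriFriedlanderIwaniecTheorem0b) (h5 : BombieriFriedlanderIwaniecTheorem5StarInterval)
    (hL3 : BombieriFriedlanderIwaniecLemma3) (hShiu : Shiu1980BrunTitchmarsh)
    (hSWμ : LFunctions.SiegelWalfiszMoebius) (hFL : SieveSequence.fundamental_lemma_uniform)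
    {a : ℤ} (ha : a ≠ 0) {ε : ℝ} (hε : 0 < ε) (hε' : ε ≤ 1 / 1000) {A₅ : ℝ} (hA₅ : 0 ≤ A₅) :
    ∃ C x₀ : ℝ, 0 ≤ C ∧ ∀ x : ℝ, x₀ ≤ x → ∀ (Δ : ℝ) (U j K : ℕ) (κ : Fin (2 * j) → ℕ) (lam : ℕ → ℝ),
      IsWellFactorable (x ^ (4 / 7 - ε)) lam → 1 ≤ j → j ≤ 7 → 0 < Δ → Δ ≤ 1 / 2 → (1 + Δ) ^ 14 ≤ 2 →
      1 ≤ U → (U : ℝ) ≤ 4 * x ^ (1 / 7 : ℝ) → κ ∈ tuples j K → Interior x Δ j κ →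
      |∑ d ∈ (Icc 1 ⌊x ^ (4 / 7 - ε)⌋₊).filter (fun d : ℕ => IsCoprime (d : ℤ) a),
          lam d * sievedDisc (fun n => prodMain x (Real.exp (Real.sqrt (Real.log x))) Δ U j κ n) d a
            (Real.exp (Real.sqrt (Real.log x))) x| ≤ C * x / Real.log x ^ A₅ := by
  obtain ⟨C, x₀, hC, hmain⟩ := genuine_pieces_bound h1 h2 h0b h5 hL3 hShiu hSWμ hFL ha hε hε' hA₅
  refine ⟨C, max x₀ 1, hC, fun x hx Δ U j K κ lam hlam hj hj7 hΔ0 hΔ2 hΔ14 hU1 hU _ hInt => ?_⟩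
  have hx₀ : x₀ ≤ x := le_trans (le_max_left _ _) hx
  have hx1 : (1 : ℝ) ≤ x := le_trans (le_max_right _ _) hx
  have hx0 : 0 < x := by linarith
  have hΔ' : -1 < Δ := by linarith
  set z : ℝ := Real.exp (Real.sqrt (Real.log x)) with hz
  -- the pieces and the scales
  set f : Fin (2 * j) → ArithmeticFunction ℝ := fun i => factorMain x z Δ U j i (κ i) with hf
  set P : Fin (2 * j) → ℝ := fun i => boxLow (2 * x) Δ (κ i) with hP
  have hprod : prodMain x z Δ U j κ = ∏ i, f i := rfl
  have hRHS : 0 ≤ C * x / Real.log x ^ A₅ :=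
    div_nonneg (mul_nonneg hC hx0.le) (Real.rpow_nonneg (Real.log_nonneg hx1) _)
  -- a zero factor kills everything
  by_cases hzero : ∃ i, f i = 0
  · obtain ⟨i, hi⟩ := hzero
    have h0 : prodMain x z Δ U j κ = 0 := by rw [hprod]; exact Finset.prod_eq_zero (Finset.mem_univ i) hi
    have : ∀ d, sievedDisc (fun n => prodMain x z Δ U j κ n) d a z x = 0 := by
      intro d; rw [h0]; exact sievedDisc_zero d a z x
    simp only [this, mul_zero, Finset.sum_const_zero, abs_zero]
    exact hRHS
  push Not at hzero
  -- genuine slots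
  set G : Finset (Fin (2 * j)) := Finset.univ.filter (fun i => 1 ≤ P i) with hGdef
  have hPG : ∀ i ∈ G, 1 ≤ P i := fun i hi => (Finset.mem_filter.1 hi).2
  have hP0 : ∀ i, 0 < P i := fun i => boxLow_pos (by linarith) hΔ' (κ i)
  have hf1 : ∀ i ∈ G, ∀ n, |f i n| ≤ 1 := fun i _ n => abs_factorMain_le_one i.isLt (κ i) n
  have hsupp : ∀ i ∈ G, ∀ n : ℕ, f i n ≠ 0 → P i < n ∧ (n : ℝ) ≤ (1 + Δ) * P i ∧ IsRough z n :=
    fun i _ n hn => factorMain_support hΔ' (κ i) hn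
  have hneG : ∀ i ∈ G, f i ≠ 0 := fun i _ => hzero i
  -- the non-genuine slots carry units, and their boxes straddle `1`
  have hunit : ∀ i, i ∉ G → f i = 1 := by
    intro i hi
    have hlow : P i < 1 := by
      by_contra h; exact hi (Finset.mem_filter.2 ⟨Finset.mem_univ i, not_lt.1 h⟩)
    exact factorMain_eq_one i.isLt hU1 hΔ0.le (by linarith) hlow (hzero i)
  have hhalf : ∀ i, i ∉ G → 1 ≤ (1 + Δ) * P i := by
    intro i hi
    obtain ⟨n, hn⟩ : ∃ n, f i n ≠ 0 := by
      by_contra h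
      push Not at h
      exact hzero i (ArithmeticFunction.ext fun n => by rw [h n]; rfl)
    have hn0 : n ≠ 0 := by rintro rfl; exact hn (by simp [hf])
    obtain ⟨-, h2, -⟩ := factorMain_support hΔ' (κ i) hn
    have : (1 : ℝ) ≤ n := by exact_mod_cast Nat.one_le_iff_ne_zero.2 hn0
    exact this.trans h2
  -- `prodMain = ∏_G f`
  have hprodG : prodMain x z Δ U j κ = ∏ i ∈ G, f i := by
    rw [hprod, ← Finset.prod_filter_mul_prod_filter_not Finset.univ (fun i => 1 ≤ P i) f]
    have : ∏ i ∈ Finset.univ.filter (fun i => ¬ 1 ≤ P i), f i = 1 :=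
      Finset.prod_eq_one fun i hi => hunit i (fun hiG => (Finset.mem_filter.1 hi).2 (hPG i hiG))
    rw [this, mul_one]
  -- the three size conditions
  have htupleLow : tupleLow x Δ j κ = (∏ i ∈ G, P i) * ∏ i ∈ Finset.univ.filter (fun i => ¬ 1 ≤ P i), P i :=
    (Finset.prod_filter_mul_prod_filter_not Finset.univ (fun i => 1 ≤ P i) P).symm
  have hNG1 : ∏ i ∈ Finset.univ.filter (fun i => ¬ 1 ≤ P i), P i ≤ 1 :=
    Finset.prod_le_one (fun i _ => (hP0 i).le) (fun i hi => (not_le.1 (Finset.mem_filter.1 hi).2).le)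
  have hNGhalf : (1 / 2 : ℝ) ^ 14 ≤ ∏ i ∈ Finset.univ.filter (fun i => ¬ 1 ≤ P i), P i := by
    have hcard : (Finset.univ.filter (fun i : Fin (2 * j) => ¬ 1 ≤ P i)).card ≤ 14 :=
      (Finset.card_filter_le _ _).trans (by rw [Finset.card_univ, Fintype.card_fin]; omega)
    calc (1 / 2 : ℝ) ^ 14 ≤ (1 / 2) ^ (Finset.univ.filter (fun i : Fin (2 * j) => ¬ 1 ≤ P i)).card :=
          pow_le_pow_of_le_one (by norm_num) (by norm_num) hcard
      _ = ∏ i ∈ Finset.univ.filter (fun i : Fin (2 * j) => ¬ 1 ≤ P i), (1 / 2 : ℝ) := (Finset.prod_const _).symm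
      _ ≤ _ := by
          refine Finset.prod_le_prod (fun _ _ => by norm_num) fun i hi => ?_
          have hiG : i ∉ G := fun hiG => (Finset.mem_filter.1 hi).2 (hPG i hiG)
          have := hhalf i hiG
          nlinarith [hP0 i, hΔ2]
  have hGP0 : 0 ≤ ∏ i ∈ G, P i := Finset.prod_nonneg fun i _ => (hP0 i).le
  have hX1 : x ≤ ∏ i ∈ G, P i := by
    have h := hInt.1
    rw [htupleLow] at h
    exact h.trans (mul_le_of_le_one_right hGP0 hNG1)
  have htupleHigh : tupleHigh x Δ j κ ≤ 2 * x := hInt.2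
  have hX2 : (∏ i ∈ G, P i) ≤ 2 ^ 15 * x := by
    have hlow_le : tupleLow x Δ j κ ≤ 2 * x := by
      have h1 : tupleLow x Δ j κ ≤ tupleHigh x Δ j κ := by
        rw [tupleHigh_eq hΔ' κ]
        exact le_mul_of_one_le_left (tupleLow_pos hx0 hΔ' κ).le (one_le_pow₀ (by linarith))
      exact h1.trans htupleHigh
    rw [htupleLow] at hlow_le
    have h2 : (∏ i ∈ G, P i) * (1 / 2 : ℝ) ^ 14 ≤ 2 * x :=
      (mul_le_mul_of_nonneg_left hNGhalf hGP0).trans hlow_le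
    have h3 : (2 : ℝ) ^ 15 * x = (2 * x) / (1 / 2 : ℝ) ^ 14 := by norm_num; ring
    rw [h3, le_div_iff₀ (by norm_num)]
    exact h2
  have hX3 : (1 + Δ) ^ G.card * ∏ i ∈ G, P i ≤ 2 * x := by
    have h1 : tupleHigh x Δ j κ = ∏ i, (1 + Δ) * P i := by
      unfold tupleHigh
      exact Finset.prod_congr rfl fun i _ => boxHigh_eq_mul_boxLow hΔ' (κ i)
    have h2 : ∏ i, (1 + Δ) * P i = (∏ i ∈ G, (1 + Δ) * P i) *
        ∏ i ∈ Finset.univ.filter (fun i => ¬ 1 ≤ P i), (1 + Δ) * P i :=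
      (Finset.prod_filter_mul_prod_filter_not _ _ _).symm
    have h3 : ∏ i ∈ G, (1 + Δ) * P i = (1 + Δ) ^ G.card * ∏ i ∈ G, P i := by
      rw [Finset.prod_mul_distrib, Finset.prod_const]
    have h4 : 1 ≤ ∏ i ∈ Finset.univ.filter (fun i => ¬ 1 ≤ P i), (1 + Δ) * P i :=
      one_le_prod_pieces (P := fun i => (1 + Δ) * P i) (subset_refl _)
        (fun i hi => hhalf i (fun hiG => (Finset.mem_filter.1 hi).2 (hPG i hiG)))
    have h5 : 0 ≤ ∏ i ∈ G, (1 + Δ) * P i := Finset.prod_nonneg fun i _ => by nlinarith [hP0 i, hΔ0]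
    calc (1 + Δ) ^ G.card * ∏ i ∈ G, P i = ∏ i ∈ G, (1 + Δ) * P i := h3.symm
      _ ≤ (∏ i ∈ G, (1 + Δ) * P i) * ∏ i ∈ Finset.univ.filter (fun i => ¬ 1 ≤ P i), (1 + Δ) * P i :=
          le_mul_of_one_le_right h5 h4
      _ = tupleHigh x Δ j κ := by rw [← h2, ← h1]
      _ ≤ 2 * x := htupleHigh
  have hG14 : G.card ≤ 14 :=
    (Finset.card_filter_le _ _).trans (by rw [Finset.card_univ, Fintype.card_fin]; omega)
  -- the types of the genuine pieces
  have htype : ∀ i ∈ G,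
      (⇑(f i) = roughBoxOne z ⌊P i⌋₊ ⌊(1 + Δ) * P i⌋₊ ∧
        ∀ n : ℕ, n ≠ 0 → f i n = if P i < n ∧ (n : ℝ) ≤ (1 + Δ) * P i then
          (if IsRough z n then 1 else 0) else 0) ∨
      (P i < U ∧ ⇑(f i) = roughBoxMoebius z ⌊P i⌋₊ (min ⌊(1 + Δ) * P i⌋₊ U)) := by
    intro i _
    by_cases hij : (i : ℕ) < j
    · right
      refine ⟨boxLow_lt_of_moebius_ne_zero hij (hzero i), ?_⟩
      have h := factorMain_coe_eq_roughBoxMoebius (z := z) (U := U) hij hx0 hΔ' (κ i)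
      rw [boxHigh_eq_mul_boxLow hΔ' (κ i)] at h
      exact h
    · left
      have hji : j ≤ (i : ℕ) := not_lt.1 hij
      refine ⟨?_, fun n hn => ?_⟩
      · have h := factorMain_coe_eq_roughBoxOne (z := z) (U := U) hji i.isLt hx0 hΔ' (κ i)
        rw [boxHigh_eq_mul_boxLow hΔ' (κ i)] at h
        exact h
      · have h := factorMain_apply_zeta (x := x) (z := z) (Δ := Δ) (U := U) hji i.isLt (κ i) hn
        rw [boxHigh_eq_mul_boxLow hΔ' (κ i)] at h
        exact h
  -- conclude
  have hsd : ∀ d : ℕ, sievedDisc (fun n => prodMain x z Δ U j κ n) d a z x =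
      sievedDisc (fun n => (∏ i ∈ G, f i) n) d a z x := fun d => by rw [hprodG]
  rw [Finset.sum_congr rfl fun d _ => by rw [hsd d]]
  exact hmain x hx₀ G f P Δ U lam hlam hΔ0 hΔ2 hΔ14 hG14 hU hPG hf1 hsupp hneG htype hX1 hX2 hX3

end BFI

end Literature.NumberTheory.Sieve
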